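import Summits.Ventures.Crystal3D.Theorems.StickyWulffConstantTextureBuildMassCover
import Summits.Ventures.Crystal3D.Theorems.StickyWulffConstantTextureBuildMeshV6
import Summits.Ventures.Crystal3D.Theorems.StickyWulffConstantTextureBuildBarlowCellVolume
import HarnessLib

/-!
# TB-energy blueprint, (L-M): THE MASS LINE `(1 − δ)·N ≤ √2 · vol(pieces)` over the v6 mesh
# (lane T, crux `TextureLiminfV5`, stmt-Ventures-23912; blueprint TexShadowTB `stub_LM`; TB-D-2-g20 §(L-M))

HONEST FRAMING. Venture `Summits/Ventures/Crystal3D` (cell `crystal3d-full`), route `route-Ventures-StickyWulffConstant`, helper `--supports` the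
law-v5 crux `TextureLiminfV5` (stmt-Ventures-23912).  Proves the MASS stub of the TB-energy blueprint for EVERY input `I : TexInput rc μ.toMesh₅` of a v6
mesh `μ` (standard axioms; no mesh constructed; F-C1 not moved).

THE ARGUMENT (no Kepler).  The `(1 − δ)N` balls counted by `Mesh₆.hmass₆` are locally perfect (`LocPerfect`: a Barlow stacking through the ball all of
whose sites within `2√2` are balls), so tb-w1's glue `card_mul_le_volume_of_closedBalls_subset` (…BarlowCellVolume) gives them pairwise-disjoint lattice
cells of volume `1/√2` inside `⋃ closedBall(a, √2)`.  These balls lie, by the same clause, in `territory ∪ deep prism parts`, and that set is a.e. covered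
by the LABELLED cells (= the pieces): prism / core cells are labelled (`isSome_lab_of_subset`), and a free-zone point `z ∈ U_f` within `√2` of a deep
REAL-COMPLETE site is `f`-solid, hence a.e. in the tent solid, hence (off the layer planes) in a tent zone, hence in a piece (`mem_pieces_of_mem_cell`).
* `TexInput.mass_le` — `(1 − δ)·N ≤ √2 · (volume (⋃ i, polytope (I.cells.Hp i))).toReal`.
-/

noncomputable section

open scoped BigOperators InnerProductSpace ENNReal
open MeasureTheory Set

namespace Summit.Ventures.Crystal3D.Cruxes.TextureLiminf.TexShadow

open Summit.Ventures.Crystal3D Summit.Ventures.Crystal3D.Theorems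
open Summit.Ventures.Crystal3D.TentCertificate (isOpen_laySlab mem_laySlab_iff)
open Literature.MathematicalPhysics.StatisticalMechanics (IsHaggSeq)

namespace TexInput

/-! ### The mass line (v6 mesh) -/

section mass

variable {C R₀ : ℝ} {N : ℕ} {x : Fin N → E3} {rc : RiseredCover C R₀ N x} {δ : ℝ}

/-- Counted balls are locally perfect. -/
theorem locPerfect_of_counted (f : Fin rc.ng) {a : E3}
    (hcase : (a ∈ rc.S f ∧ ∀ b ∈ rc.S f, dist a b ≤ 2 * Real.sqrt 2 → b ∈ (rc.tent f).Xh ∧ b ∈ rc.X') ∨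
      (Disjoint (Metric.closedBall a (Real.sqrt 2)) (rc.tent f).U ∧ rc.LocPerfect a)) : rc.LocPerfect a := by
  rcases hcase with ⟨ha, hreal⟩ | ⟨_, h⟩
  · exact ⟨(rc.tent f).L, (rc.tent f).s, (rc.tent f).σ, (rc.tent f).hσ, ha, fun b hb hd => (hreal b hb hd).2⟩
  · exact h

/-- The filled configuration is `1`-separated. -/
theorem X'_pairwise : (↑rc.X' : Set E3).Pairwise fun p q => 1 ≤ dist p q := by
  intro p hp q hq hpq
  simp only [CellCover.X', Finset.coe_image, Finset.coe_univ, image_univ, mem_range] at hp hq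
  obtain ⟨i, rfl⟩ := hp
  obtain ⟨j, rfl⟩ := hq
  exact rc.hx'.one_le_dist fun h => hpq (by rw [h])

/-- **(L-M) THE MASS LINE** (`stub_LM` of the blueprint, for every input of a v6 mesh): `(1 − δ)·N ≤ √2 · vol(pieces)`. -/
theorem mass_le {μ : Mesh₆ rc δ} (I : TexInput rc μ.toMesh₅) : (1 - δ) * (N : ℝ) ≤ Real.sqrt 2 * (volume (⋃ i, polytope (I.cells.Hp i))).toReal := by
  classical
  -- the counted balls
  set P : Fin rc.N' → Prop := fun i => ∃ f,
      ((rc.x' i ∈ rc.S f ∧ ∀ b ∈ rc.S f, dist (rc.x' i) b ≤ 2 * Real.sqrt 2 → b ∈ (rc.tent f).Xh ∧ b ∈ rc.X') ∨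
        (Disjoint (Metric.closedBall (rc.x' i) (Real.sqrt 2)) (rc.tent f).U ∧ rc.LocPerfect (rc.x' i))) ∧
      Metric.closedBall (rc.x' i) (Real.sqrt 2) ⊆ (⋃ j, polytope (μ.HD f j)) ∪
        (⋃ k ∈ (Finset.univ.filter fun k => μ.fk k = f), (closure (polytope (μ.HP k)) ∩ {z | rc.height k z ≤ -1})) ∪
        (⋃ k ∈ (Finset.univ.filter fun k => μ.gk k = f), (closure (polytope (μ.HP k)) ∩ {z | (rc.cell k).h + 1 ≤ rc.height k z})) with hP
  set Sset : Finset (Fin rc.N') := Finset.univ.filter P with hSset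
  have hmass : (1 - δ) * (N : ℝ) ≤ (Sset.card : ℝ) := μ.hmass₆
  set B : Finset E3 := Sset.image rc.x' with hB
  have hcard : B.card = Sset.card := Finset.card_image_of_injective _ rc.hx'.injective
  have hBP : ∀ a ∈ B, ∃ i, rc.x' i = a ∧ P i := fun a ha => by
    obtain ⟨i, hi, rfl⟩ := Finset.mem_image.1 ha
    exact ⟨i, rfl, (Finset.mem_filter.1 hi).2⟩
  have hperf : ∀ a ∈ B, rc.LocPerfect a := fun a ha => by
    obtain ⟨i, rfl, ⟨f, hcase, _⟩⟩ := hBP a ha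
    exact locPerfect_of_counted f hcase
  -- the stackings through the counted balls
  let L : E3 → (E3 ≃ₗᵢ[ℝ] E3) := fun a => if h : rc.LocPerfect a then h.choose else LinearIsometryEquiv.refl ℝ E3
  let s : E3 → E3 := fun a => if h : rc.LocPerfect a then h.choose_spec.choose else 0
  let σ : E3 → ℤ → ℤ := fun a => if h : rc.LocPerfect a then h.choose_spec.choose_spec.choose else fun _ => 1
  have hspec : ∀ a ∈ B, IsHaggSeq (σ a) ∧ a ∈ stacking (L a) (s a) (σ a) ∧
      ∀ b ∈ stacking (L a) (s a) (σ a), dist a b ≤ 2 * Real.sqrt 2 → b ∈ (↑rc.X' : Set E3) := fun a ha => by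
    have h := hperf a ha
    have := h.choose_spec.choose_spec.choose_spec
    simp only [L, s, σ, dif_pos h]
    exact ⟨this.1, this.2.1, fun b hb hd => this.2.2 b hb hd⟩
  -- the glue: disjoint lattice cells inside the balls
  have hglue := card_mul_le_volume_of_closedBalls_subset (X'_pairwise (rc := rc)) B L s σ (fun a ha => (hspec a ha).1)
    (fun a ha => (hspec a ha).2.1) (fun a ha => (hspec a ha).2.2) (T := ⋃ a ∈ B, Metric.closedBall a (Real.sqrt 2)) subset_rfl
  -- the balls are a.e. covered by the pieces
  have hcov : volume ((⋃ a ∈ B, Metric.closedBall a (Real.sqrt 2)) \ I.pieceSet) = 0 := by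
    refine measure_mono_null (fun z hz => ?_) I.volume_massNull
    obtain ⟨hz, hzp⟩ := hz
    obtain ⟨a, ha, hza⟩ := mem_iUnion₂.1 hz
    by_contra hzN
    obtain ⟨i, rfl, ⟨f, hcase, hcont⟩⟩ := hBP a ha
    exact hzp (I.mem_pieceSet_of_counted f hcase hza (hcont hza) hzN)
  have hvol : volume (⋃ a ∈ B, Metric.closedBall a (Real.sqrt 2)) ≤ volume I.pieceSet := by
    calc volume (⋃ a ∈ B, Metric.closedBall a (Real.sqrt 2))
        ≤ volume (((⋃ a ∈ B, Metric.closedBall a (Real.sqrt 2)) ∩ I.pieceSet) ∪ ((⋃ a ∈ B, Metric.closedBall a (Real.sqrt 2)) \ I.pieceSet)) :=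
          measure_mono (fun z hz => by by_cases h : z ∈ I.pieceSet; exacts [Or.inl ⟨hz, h⟩, Or.inr ⟨hz, h⟩])
      _ ≤ volume ((⋃ a ∈ B, Metric.closedBall a (Real.sqrt 2)) ∩ I.pieceSet) + volume ((⋃ a ∈ B, Metric.closedBall a (Real.sqrt 2)) \ I.pieceSet) :=
          measure_union_le _ _
      _ ≤ volume I.pieceSet + 0 := by rw [hcov]; exact add_le_add (measure_mono inter_subset_right) le_rfl
      _ = volume I.pieceSet := add_zero _
  -- finiteness of the piece volume
  have hfin : volume I.pieceSet ≠ ⊤ :=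
    (Bornology.isBounded_iUnion.2 fun i => I.cells.hbd_Hp i).measure_lt_top.ne
  have h := ENNReal.toReal_mono hfin (hglue.trans hvol)
  rw [ENNReal.toReal_mul, ENNReal.toReal_natCast, ENNReal.toReal_ofReal (by positivity)] at h
  have h2 : Real.sqrt 2 * Real.sqrt 2 = 2 := Real.mul_self_sqrt (by norm_num)
  have hc : ((Sset.card : ℕ) : ℝ) = (B.card : ℝ) := by rw [hcard]
  show (1 - δ) * (N : ℝ) ≤ Real.sqrt 2 * (volume I.pieceSet).toReal
  calc (1 - δ) * (N : ℝ) ≤ (Sset.card : ℝ) := hmass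
    _ = (B.card : ℝ) * (Real.sqrt 2 / 2) * Real.sqrt 2 := by rw [hc, mul_assoc, div_mul_eq_mul_div, h2]; ring
    _ ≤ (volume I.pieceSet).toReal * Real.sqrt 2 := mul_le_mul_of_nonneg_right h (Real.sqrt_nonneg _)
    _ = Real.sqrt 2 * (volume I.pieceSet).toReal := mul_comm _ _

end mass

end TexInput

end Summit.Ventures.Crystal3D.Cruxes.TextureLiminf.TexShadow

end
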